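import Summits.Ventures.PercRepro.C025ProfileTwoFlatTFLayers
import Summits.Ventures.PercRepro.C025ProfileLayerCake

/-!
# FROM PER-LAYER DOMINANCE TO THE ROWS OF `M ⊕ U_{m,m}` — THE ABSTRACT BRIDGE (night-3 g27)

`proofs/NIGHT3-G27-PLD.md` §3, for an arbitrary finite index set `S` of «fat types» with rank `c i` and corank `f i`
(for a matroid: `S` = the subsets `I` of the ground set, `c I = ρ(I)`, `f I = ρ(E ∖ I)`).  PER-LAYER DOMINANCE of `(S, c, f)`:
for `Θ ≤ lo + hi + δ` with `lo = 0` or `Θ = lo + hi + δ`,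
  `Σ_{i : lo ≤ c i ≤ hi, Θ ≤ f i + c i} C(f i, δ) ≤ Σ_{i : lo + δ ≤ f i ≤ hi + δ} C(f i, δ)`.
THE ROW `(q, u)` of `(S, c, f) ⊕ m` free points, `e = u − q`:
  `Σ_{i : c i ≤ q, u ≤ f i + (m − (q − c i))} C(m, q − c i)·C(f i + (m − (q − c i)), e) ≤ C(u, q)·Σ_{i : f i ≤ u} C(m, u − f i)`
(the members `I ⊔ Z₃`, `#Z₃ = q − c`, priced by `C(ρ(E∖B), e)`; the level-`u` sets `J ⊔ Y₃` with `ρ(J) = f`, counted through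
`J ↦ E ∖ J`).  `rows_of_pld`: the left side is `Σ_δ C(m, e−δ)·Σ_x C(m − (e−δ), q − x)·Src_δ(x)`, the right side the same with
`Slot_δ(x)` (`member_term_eq`, `slot_term_eq`), and in each layer the layer-cake lemma reduces the weighted inequality to
per-layer dominance on the intervals `[q + j − M, q − j]`.  No `def`, no `instance`, no notation.  Axioms: standard.
-/

namespace PercRepro

namespace PLDBridge

open Finset

variable {ι : Type} (S : Finset ι) (c f : ι → ℕ)

/-- The sources of a layer over an interval of positions, collapsed (abstract index set). -/
theorem layer_src_eq (δ Θ lo hi : ℕ) (T : Finset ℕ) (hT : ∀ x, x ∈ T ↔ lo ≤ x ∧ x ≤ hi) :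
    (∑ x ∈ T, ∑ i ∈ S, (if c i = x ∧ Θ ≤ f i + x then (f i).choose δ else 0)) =
      ∑ i ∈ S, (if lo ≤ c i ∧ c i ≤ hi ∧ Θ ≤ f i + c i then (f i).choose δ else 0) := by
  rw [sum_comm]
  apply sum_congr rfl
  intro i _
  have h1 : ∀ x, (if c i = x ∧ Θ ≤ f i + x then (f i).choose δ else 0) =
      if c i = x then (if Θ ≤ f i + x then (f i).choose δ else 0) else 0 := by
    intro x
    split_ifs <;> first | rfl | (exfalso; tauto)
  simp only [h1]
  rw [sum_ite_eq]
  by_cases hmem : c i ∈ T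
  · rw [if_pos hmem]
    rw [hT] at hmem
    split_ifs <;> first | rfl | (exfalso; omega)
  · rw [if_neg hmem]
    rw [hT] at hmem
    rw [if_neg]
    intro h
    exact hmem ⟨h.1, h.2.1⟩

/-- The slots of a layer over an interval of positions, collapsed (abstract index set). -/
theorem layer_slot_eq (δ lo hi : ℕ) (T : Finset ℕ) (hT : ∀ x, x ∈ T ↔ lo ≤ x ∧ x ≤ hi) :
    (∑ x ∈ T, ∑ i ∈ S, (if f i = x + δ then (x + δ).choose x else 0)) =
      ∑ i ∈ S, (if lo + δ ≤ f i ∧ f i ≤ hi + δ then (f i).choose δ else 0) := by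
  rw [sum_comm]
  apply sum_congr rfl
  intro i _
  have h1 : ∀ x, (if f i = x + δ then (x + δ).choose x else 0) =
      if f i - δ = x then (if δ ≤ f i then (f i).choose δ else 0) else 0 := by
    intro x
    by_cases h : f i = x + δ
    · rw [if_pos h, if_pos (by omega), if_pos (by omega), h, Nat.choose_symm_add]
    · rw [if_neg h]
      by_cases h' : f i - δ = x
      · rw [if_pos h', if_neg (by omega)]
      · rw [if_neg h']
  simp only [h1]
  rw [sum_ite_eq]
  by_cases hmem : f i - δ ∈ T
  · rw [if_pos hmem]
    rw [hT] at hmem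
    split_ifs <;> first | rfl | (exfalso; omega)
  · rw [if_neg hmem]
    rw [hT] at hmem
    rw [if_neg]
    intro h
    exact hmem ⟨by omega, by omega⟩

/-- **The layer inequality** (abstract): per-layer dominance on intervals gives, in layer `δ ≤ u − q` with
`u − q − δ ≤ m`, `Σ_x C(M, q−x)·Src_δ(x) ≤ Σ_x C(M, q−x)·Slot_δ(x)`. -/
theorem layer_ineq (m q u δ : ℕ) (hqu : q ≤ u) (hδ : δ ≤ u - q) (hm : u - q - δ ≤ m)
    (hPLD : ∀ lo hi Θ : ℕ, Θ ≤ lo + hi + δ → (lo = 0 ∨ lo + hi + δ ≤ Θ) →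
      (∑ i ∈ S, (if lo ≤ c i ∧ c i ≤ hi ∧ Θ ≤ f i + c i then (f i).choose δ else 0)) ≤
        ∑ i ∈ S, (if lo + δ ≤ f i ∧ f i ≤ hi + δ then (f i).choose δ else 0)) :
    (∑ x ∈ range (q + 1), (m - (u - q - δ)).choose (q - x) *
        ∑ i ∈ S, (if c i = x ∧ u + q - m ≤ f i + x then (f i).choose δ else 0)) ≤
      ∑ x ∈ range (q + 1), (m - (u - q - δ)).choose (q - x) *
        ∑ i ∈ S, (if f i = x + δ then (x + δ).choose x else 0) := by
  apply LayerCake.sum_choose_mul_le_of_intervals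
  intro j hj
  by_cases hjq : j ≤ q
  · set M := m - (u - q - δ) with hM
    set T := (range (q + 1)).filter (fun x => j ≤ q - x ∧ q - x + j ≤ M) with hTdef
    have hT : ∀ x, x ∈ T ↔ q + j - M ≤ x ∧ x ≤ q - j := by
      intro x
      rw [hTdef, mem_filter, mem_range]
      omega
    rw [layer_src_eq S c f δ (u + q - m) (q + j - M) (q - j) T hT, layer_slot_eq S f δ (q + j - M) (q - j) T hT]
    apply hPLD
    · omega
    · omega
  · have hempty : (range (q + 1)).filter (fun x => j ≤ q - x ∧ q - x + j ≤ m - (u - q - δ)) = ∅ := by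
      rw [filter_eq_empty_iff]
      intro x hx
      rw [mem_range] at hx
      omega
    rw [hempty, sum_empty, sum_empty]

/-- Moving an outer sum inside two inner sums (abstract index set). -/
theorem sum_swap3 (C D : Finset ℕ) (F : ι → ℕ → ℕ → ℕ) :
    (∑ i ∈ S, ∑ δ ∈ C, ∑ x ∈ D, F i δ x) = ∑ δ ∈ C, ∑ x ∈ D, ∑ i ∈ S, F i δ x := by
  rw [sum_comm]
  apply sum_congr rfl
  intro δ _
  rw [sum_comm]

/-- Factoring the scalars of a layer out of a flat sum (abstract index set). -/
theorem sum_factor (a : ℕ) (D : Finset ℕ) (b : ℕ → ℕ) (t : ι → ℕ → ℕ) :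
    (∑ x ∈ D, ∑ i ∈ S, a * (b x * t i x)) = a * ∑ x ∈ D, b x * ∑ i ∈ S, t i x := by
  rw [mul_sum]
  apply sum_congr rfl
  intro x _
  rw [mul_sum, mul_sum]

/-- **THE ROWS OF `(S, c, f) ⊕ m` FROM PER-LAYER DOMINANCE** (abstract index set). -/
theorem rows_of_pld (m q u : ℕ) (hqu : q < u)
    (hPLD : ∀ lo hi δ Θ : ℕ, Θ ≤ lo + hi + δ → (lo = 0 ∨ lo + hi + δ ≤ Θ) →
      (∑ i ∈ S, (if lo ≤ c i ∧ c i ≤ hi ∧ Θ ≤ f i + c i then (f i).choose δ else 0)) ≤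
        ∑ i ∈ S, (if lo + δ ≤ f i ∧ f i ≤ hi + δ then (f i).choose δ else 0)) :
    (∑ i ∈ S, (if c i ≤ q ∧ u ≤ f i + (m - (q - c i)) then
        m.choose (q - c i) * (f i + (m - (q - c i))).choose (u - q) else 0)) ≤
      u.choose q * ∑ i ∈ S, (if f i ≤ u then m.choose (u - f i) else 0) := by
  have hL : (∑ i ∈ S, (if c i ≤ q ∧ u ≤ f i + (m - (q - c i)) then
        m.choose (q - c i) * (f i + (m - (q - c i))).choose (u - q) else 0)) =
      ∑ δ ∈ range (u - q + 1), m.choose (u - q - δ) *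
        ∑ x ∈ range (q + 1), (m - (u - q - δ)).choose (q - x) *
          ∑ i ∈ S, (if c i = x ∧ u + q - m ≤ f i + x then (f i).choose δ else 0) := by
    have h1 : ∀ i, (if c i ≤ q ∧ u ≤ f i + (m - (q - c i)) then
          m.choose (q - c i) * (f i + (m - (q - c i))).choose (u - q) else 0) =
        ∑ δ ∈ range (u - q + 1), ∑ x ∈ range (q + 1), m.choose (u - q - δ) * ((m - (u - q - δ)).choose (q - x) *
          (if c i = x ∧ u + q - m ≤ f i + x then (f i).choose δ else 0)) := by
      intro i
      rw [TwoFlatPLD.member_term_eq m q u (f i) (c i)]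
      apply sum_congr rfl
      intro δ _
      have h2 := TwoFlatPLD.sum_range_ite_pos q (c i) ((f i).choose δ)
        (fun x => u + q - m ≤ f i + x) (fun x => (m - (u - q - δ)).choose (q - x))
      rw [← mul_sum, h2]
      split_ifs <;> ring
    simp only [h1]
    rw [sum_swap3]
    apply sum_congr rfl
    intro δ _
    rw [sum_factor]
  have hR : u.choose q * (∑ i ∈ S, (if f i ≤ u then m.choose (u - f i) else 0)) =
      ∑ δ ∈ range (u - q + 1), m.choose (u - q - δ) *
        ∑ x ∈ range (q + 1), (m - (u - q - δ)).choose (q - x) *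
          ∑ i ∈ S, (if f i = x + δ then (x + δ).choose x else 0) := by
    rw [mul_sum]
    have h1 : ∀ i, u.choose q * (if f i ≤ u then m.choose (u - f i) else 0) =
        ∑ δ ∈ range (u - q + 1), ∑ x ∈ range (q + 1), m.choose (u - q - δ) * ((m - (u - q - δ)).choose (q - x) *
          (if f i = x + δ then (x + δ).choose x else 0)) := by
      intro i
      rw [TwoFlatPLD.slot_term_eq m q u (f i) hqu.le]
      apply sum_congr rfl
      intro δ _
      rw [mul_sum]
    simp only [h1]
    rw [sum_swap3]
    apply sum_congr rfl
    intro δ _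
    rw [sum_factor]
  rw [hL, hR]
  apply sum_le_sum
  intro δ hδ
  rw [mem_range] at hδ
  by_cases hm : u - q - δ ≤ m
  · exact Nat.mul_le_mul_left _ (layer_ineq S c f m q u δ hqu.le (by omega) hm (fun lo hi Θ => hPLD lo hi δ Θ))
  · rw [Nat.choose_eq_zero_of_lt (by omega), zero_mul, zero_mul]

end PLDBridge

end PercRepro
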